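import Summits.ResolutionOfSingularities.ResolutionOfSingularities.Theorems.DescentPerfectToAll.Negative.ConstantsOfTwistedDerivation
import HarnessLib

/-!
# `DescentPerfectToAll` — negative lemma, part 3: the twisted derivation is not p-closed

Support (negative) lemma for crux `stmt-ResolutionOfSingularities-0549`
(`Summit.ResolutionOfSingularities.ResolutionOfSingularities.Theses.WeightedInvariant.DescentPerfectToAll`),
filed by the standing disprover (cdisprove gen 3). Parts 1–2
(`ConstantsOfTwistedDerivation.lean`, `InvariantsRegularOfNonsingularDerivationFalse.lean`) refute the
card lemma `InvariantsRegularOfNonsingularDerivation` with the twisted derivation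
`D = ∂₀ + X₀·(X₁∂₁ + X₂∂₂)` of `k⟦X₀, X₁, X₂⟧`. This file certifies that the witness separates the
card lemma from its REPAIR (`Cruxes/DescentPerfectToAll/Disproof.lean` §8,
`InvariantsRegularOfPClosedNonsingularDerivation`: add p-closedness `∃ a, ∀ x, D^[p] x = a * D x`)
EXACTLY at p-closedness: `D` satisfies every other hypothesis of the repaired lemma (regular local
ring, unit value `D X₀ = 1`, module-finiteness over the constants — parts 1–2) but is NOT p-closed;
indeed `¬ ∃ a, ∀ x, D^[n] x = a * D x` for every `n ≥ 2`, in any characteristic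
(`not_exists_iterate_eq_mul`): `D^[n] X₀ = 0` forces `a = 0`, while `D^[n] X₁ = q_n(X₀)·X₁` with
`q_{n+1} = q_n' + X₀ q_n` MONIC of degree `n` (`coeff_iterate_D_X_one`), so `D^[n] X₁ ≠ 0`.
No definition is declared (`D` is a variable with its defining equation `hD`, as in part 1).

## Sources
* A. G. Aramova, L. L. Avramov, Singularities of quotients by vector fields in characteristic `p`,
  Math. Ann. 273 (1986) 629–645 (p-closed derivations). [folklore computation here]
-/

noncomputable section

open MvPowerSeries IsLocalRing Finsupp
open Literature.AlgebraicGeometry.Resolution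

set_option linter.dupNamespace false

namespace Summit.ResolutionOfSingularities.ResolutionOfSingularities.Theorems.DescentPerfectToAll.Negative

variable (k : Type) [Field k]
variable (D : Derivation k (MvPowerSeries (Fin 3) k) (MvPowerSeries (Fin 3) k))
  (hD : D = MvPowerSeries.pderiv 0 +
    (X 0 : MvPowerSeries (Fin 3) k) • (MvPowerSeries.eulerDerivation 1 + MvPowerSeries.eulerDerivation 2))
include hD

/-- `D^[n+1] X₀ = 0`: after one step the value is the constant `1`, which `D` kills. [folklore] -/
theorem iterate_D_X_zero (n : ℕ) : D^[n + 2] (X 0) = 0 := by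
  induction n with
  | zero => rw [Function.iterate_succ_apply, Function.iterate_one, D_X_zero k D hD]; exact D.map_one_eq_zero
  | succ n ih => rw [Function.iterate_succ_apply', ih, map_zero]

/-- **`D^[n] X₁ = q_n(X₀)·X₁` with `q_n` monic of degree `n`**, at the level of coefficients: the
iterate is supported on the monomials `X₀ʲ X₁`, `j ≤ n`, and its coefficient at `X₀ⁿ X₁` is `1`.
[folklore] -/
theorem coeff_iterate_D_X_one (n : ℕ) :
    (∀ m : Fin 3 →₀ ℕ, coeff m (D^[n] (X 1)) ≠ 0 → m 1 = 1 ∧ m 2 = 0 ∧ m 0 ≤ n) ∧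
      coeff (equivFunOnFinite.symm ![n, 1, 0]) (D^[n] (X 1)) = 1 := by
  classical
  induction n with
  | zero =>
    refine ⟨fun m hm => ?_, ?_⟩
    · rw [Function.iterate_zero_apply, coeff_X] at hm
      split_ifs at hm with h
      · subst h; simp
      · exact absurd rfl hm
    · rw [Function.iterate_zero_apply, coeff_X, if_pos]
      ext i; fin_cases i <;> simp
  | succ n ih =>
    obtain ⟨hsupp, htop⟩ := ih
    have hzero : ∀ m : Fin 3 →₀ ℕ, ¬ (m 1 = 1 ∧ m 2 = 0 ∧ m 0 ≤ n) → coeff m (D^[n] (X 1)) = 0 :=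
      fun m hm => by_contra fun h => hm (hsupp m h)
    refine ⟨fun m hm => ?_, ?_⟩
    · rw [Function.iterate_succ_apply', coeff_D k D hD] at hm
      by_contra hcon
      apply hm
      have h1 : coeff (m + single 0 1) (D^[n] (X 1)) = 0 := by
        apply hzero
        rintro ⟨ha, hb, hc⟩
        simp only [Finsupp.add_apply, single_eq_same, single_eq_of_ne (show (1 : Fin 3) ≠ 0 by decide),
          single_eq_of_ne (show (2 : Fin 3) ≠ 0 by decide), add_zero] at ha hb hc
        exact hcon ⟨ha, hb, by omega⟩
      have h2 : (if single 0 1 ≤ m then ((m 1 : k) + (m 2 : k)) * coeff (m - single 0 1) (D^[n] (X 1))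
          else 0) = 0 := by
        split_ifs with hle
        · rw [hzero, mul_zero]
          rintro ⟨ha, hb, hc⟩
          simp only [Finsupp.tsub_apply, single_eq_same, single_eq_of_ne (show (1 : Fin 3) ≠ 0 by decide),
            single_eq_of_ne (show (2 : Fin 3) ≠ 0 by decide), Nat.sub_zero] at ha hb hc
          exact hcon ⟨ha, hb, by omega⟩
        · rfl
      rw [h1, h2, mul_zero, add_zero]
    · rw [Function.iterate_succ_apply', coeff_D k D hD, fs_add_single, fs_sub_single,
        if_pos ((single_le_fs _ _ _).mpr (by omega)), Nat.add_sub_cancel, htop, hzero, mul_zero,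
        zero_add]
      · simp
      · simp

/-- `D^[n] X₁ ≠ 0` for every `n`. [folklore] -/
theorem iterate_D_X_one_ne_zero (n : ℕ) : D^[n] (X 1) ≠ 0 := fun h => by
  have := (coeff_iterate_D_X_one k D hD n).2
  rw [h, map_zero] at this
  exact zero_ne_one this

/-- **The twisted derivation is not p-closed** (for any exponent `n ≥ 2`, in any characteristic):
there is no `a` with `D^[n] = a·D`. With `n = p` this is the failure of the p-closedness hypothesis of
the repaired card lemma `InvariantsRegularOfPClosedNonsingularDerivation` (Disproof.lean §8) for the
witness of `not_invariantsRegularOfNonsingularDerivation`. [folklore] -/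
theorem not_exists_iterate_eq_mul {n : ℕ} (hn : 2 ≤ n) :
    ¬ ∃ a : MvPowerSeries (Fin 3) k, ∀ x, D^[n] x = a * D x := by
  rintro ⟨a, ha⟩
  obtain ⟨m, rfl⟩ : ∃ m, n = m + 2 := ⟨n - 2, by omega⟩
  have h0 := ha (X 0)
  rw [iterate_D_X_zero k D hD, D_X_zero k D hD, mul_one] at h0
  have h1 := ha (X 1)
  rw [← h0, zero_mul] at h1
  exact iterate_D_X_one_ne_zero k D hD _ h1

/-- The case `n = p`: **the witness derivation is not p-closed.** [folklore] -/
theorem not_pClosed (p : ℕ) [Fact p.Prime] :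
    ¬ ∃ a : MvPowerSeries (Fin 3) k, ∀ x, D^[p] x = a * D x :=
  not_exists_iterate_eq_mul k D hD (Fact.out : p.Prime).two_le

end Summit.ResolutionOfSingularities.ResolutionOfSingularities.Theorems.DescentPerfectToAll.Negative
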